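import Mathlib
import Literature.Analysis.Complex.CauchyTransform
import Literature.Analysis.Complex.CauchyPompeiu
import Literature.Analysis.Complex.CauchyTransformHolder
import Literature.Analysis.Complex.CauchyTransformHolderHigher
import Literature.Analysis.Calculus.SmoothImplicitFunction
import Literature.Analysis.FunctionSpaces.ContDiffHolderSpace
import Literature.Analysis.FunctionSpaces.ContDiffHolderBilinear
import Literature.Analysis.FunctionSpaces.ContDiffHolderLocalization
import Literature.Geometry.Symplectic.JHolomorphicMap
import Summits.SmoothPoincare4.SmoothPoincare4.Theorems.SullivanDualTameOrBrodyR4PencilDefs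
import Summits.SmoothPoincare4.SmoothPoincare4.Theorems.SullivanDualTameOrBrodyR4HelperComplexTrivialisation
import Summits.SmoothPoincare4.SmoothPoincare4.Theorems.SullivanDualTameOrBrodyR4HelperMemberFrame
import Summits.SmoothPoincare4.SmoothPoincare4.Theorems.SullivanDualTameOrBrodyR4HelperLinearisationTriangular
import Summits.SmoothPoincare4.SmoothPoincare4.Theorems.SullivanDualTameOrBrodyR4HelperDecayingKernelZero
import Summits.SmoothPoincare4.SmoothPoincare4.Theorems.SullivanDualTameOrBrodyR4CoreAOperators
import Summits.SmoothPoincare4.SmoothPoincare4.Theorems.SullivanDualTameOrBrodyR4CoreAFredholm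
import Summits.SmoothPoincare4.SmoothPoincare4.Theorems.SullivanDualTameOrBrodyR4ContinuityEstimates

/-!
# CORE-A of crux `TameOrBrodyR4` (stmt-SmoothPoincare4-7826), line `Sketch`: the chart data at a
# pencil member (lead c6, assembly layer A6 — PLAN FILE: interfaces fixed, proofs delegated)

For a pencil member `u₀` (value `b₀`) this file fixes the GEOMETRIC, order-independent data of the
implicit-function-theorem chart at `u₀` — the adapted frame `Ψ` and its inverse
(`helper_memberFrame`), the conjugated linearisation `S` (`helper_linearisationTriangular`), the
coefficient `A`, three nested smooth cut-offs `χ ⊂ χ₁` and the radii — bundled as `ChartData`,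
and states the facts the assembly consumes:

* `exists_chartData` — existence of chart data at every member;
* `ChartData` facts: `S` smooth, bounded, triangular, compactly supported; `A = 0` and `Ψ`
  standard outside the inner disc; the cut-off nesting; `χ₁ (A + DJ-term) = …`.

The analytic objects built ON these data at each Hölder order `k` (the `VorticityData`, the
compactness of `L - 1`, the triviality of its kernel, the Fredholm step and the implicit function)
are the sibling files `…CoreAChartVorticity.lean`, `…CoreAChartFamily.lean`.
-/

-- the registered namespace `Summit.SmoothPoincare4.SmoothPoincare4.…` repeats a component
set_option linter.dupNamespace false

noncomputable section

open scoped ContDiff Topology NNReal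
open Filter Set Function Metric Literature.Analysis.Complex Literature.Analysis.FunctionSpaces
  Literature.Geometry.Symplectic

namespace Summit.SmoothPoincare4.SmoothPoincare4.Cruxes.TameOrBrodyR4.Sketch

namespace CoreA

/-- Local notation for the model space `ℝ⁴ = EuclideanSpace ℝ (Fin 4)`. -/
local notation "E4" => EuclideanSpace ℝ (Fin 4)
/-- Local notation for the complex model plane `ℂ²`. -/
local notation "F2" => ℂ × ℂ

/-! ### Smooth radial cut-offs -/

/-- **Smooth cut-off between two radii**: `χ = 1` on the closed `a`-disc, `χ = 0` off the open
`b`-disc, `0 ≤ χ ≤ 1`, `C^∞`, compactly supported (Mathlib's `ContDiffBump` at the origin). -/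
theorem exists_cutoff {a b : ℝ} (ha : 0 < a) (hab : a < b) :
    ∃ χ : ℂ → ℝ, ContDiff ℝ ∞ χ ∧ HasCompactSupport χ ∧ (∀ z, ‖z‖ ≤ a → χ z = 1) ∧
      (∀ z, b ≤ ‖z‖ → χ z = 0) ∧ (∀ z, 0 ≤ χ z ∧ χ z ≤ 1) := by
  let f : ContDiffBump (0 : ℂ) := ⟨a, b, ha, hab⟩
  refine ⟨f, f.contDiff, f.hasCompactSupport, fun z hz => ?_, fun z hz => ?_,
    fun z => ⟨f.nonneg, f.le_one⟩⟩
  · exact f.one_of_mem_closedBall (by simpa using hz)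
  · apply f.zero_of_le_dist; simpa using hz

/-! ### The chart data -/

/-- **Chart data at a pencil member** `u₀` of value `b₀` for the structure `J` (standard in the
frame `(P, Q, eP, eQ)` outside radius `R`): the adapted frame and its inverse with their
properties, the coefficient fields `A` (zeroth-order coefficient of the conjugated NONLINEAR
equation's linear part) and `S` (conjugated linearisation: `S = A + Ψ⁻¹ (DJ(u₀)(Ψ ·))(∂_y u₀)`),
radii `0 < ρ₁`, `ρ₂ = ρ₁ + 1`, and cut-offs `χ` (`= 1` on the closed `ρ₂`-disc, `= 0` off the
`(ρ₂+1)`-disc) and `χ₁` (`= 1` on the closed `(ρ₂+1)`-disc, `= 0` off the `(ρ₂+2)`-disc). -/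
structure ChartData (J : E4 → E4 →L[ℝ] E4) (R : ℝ) (P Q : E4 →L[ℝ] ℂ) (eP eQ : ℂ →L[ℝ] E4)
    (b₀ : ℂ) (u₀ : ℂ → E4) where
  /-- the adapted frame -/
  Ψ : ℂ → F2 →L[ℝ] E4
  /-- its inverse -/
  Ψinv : ℂ → E4 →L[ℝ] F2
  /-- frame bound -/
  CΨ : ℝ
  /-- inner radius -/
  ρ₁ : ℝ
  /-- the inner cut-off -/
  χ : ℂ → ℝ
  /-- the outer cut-off -/
  χ₁ : ℂ → ℝ
  hρ₁ : 0 < ρ₁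
  hΨs : ContDiff ℝ ∞ Ψ
  hΨinvs : ContDiff ℝ ∞ Ψinv
  hleft : ∀ ξ, (Ψinv ξ).comp (Ψ ξ) = ContinuousLinearMap.id ℝ F2
  hright : ∀ ξ, (Ψ ξ).comp (Ψinv ξ) = ContinuousLinearMap.id ℝ E4
  hΨJ : ∀ ξ (y : F2), Ψ ξ (Complex.I • y) = J (u₀ ξ) (Ψ ξ y)
  hΨt : ∀ ξ (y₁ : ℂ), Ψ ξ (y₁, 0) = fderiv ℝ u₀ ξ y₁
  hΨfar : ∀ ξ, ρ₁ ≤ ‖ξ‖ → ∀ y : F2, Ψ ξ y = fderiv ℝ u₀ ξ y.1 + eQ y.2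
  hΨbd : ∀ ξ, ‖Ψ ξ‖ ≤ CΨ
  hΨinvbd : ∀ ξ, ‖Ψinv ξ‖ ≤ CΨ
  hfar : ∀ ξ, ρ₁ ≤ ‖ξ‖ → R + 1 ≤ ‖P (u₀ ξ)‖
  hχ : ContDiff ℝ ∞ χ
  hχs : HasCompactSupport χ
  hχ_one : ∀ z, ‖z‖ ≤ ρ₁ + 1 → χ z = 1
  hχ_zero : ∀ z, ρ₁ + 2 ≤ ‖z‖ → χ z = 0
  hχ_range : ∀ z, 0 ≤ χ z ∧ χ z ≤ 1
  hχ₁ : ContDiff ℝ ∞ χ₁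
  hχ₁s : HasCompactSupport χ₁
  hχ₁_one : ∀ z, ‖z‖ ≤ ρ₁ + 2 → χ₁ z = 1
  hχ₁_zero : ∀ z, ρ₁ + 3 ≤ ‖z‖ → χ₁ z = 0
  hχ₁_range : ∀ z, 0 ≤ χ₁ z ∧ χ₁ z ≤ 1

namespace ChartData

variable {J : E4 → E4 →L[ℝ] E4} {R : ℝ} {P Q : E4 →L[ℝ] ℂ} {eP eQ : ℂ →L[ℝ] E4} {b₀ : ℂ}
  {u₀ : ℂ → E4} (𝒞 : ChartData J R P Q eP eQ b₀ u₀)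

/-- The coefficient `A ξ = Ψ⁻¹ (∂ₓΨ + J(u₀) ∂_yΨ)` of the conjugated equation. -/
def A (ξ : ℂ) : F2 →L[ℝ] F2 :=
  (𝒞.Ψinv ξ).comp ((fderiv ℝ 𝒞.Ψ ξ (1 : ℂ)) + (J (u₀ ξ)).comp (fderiv ℝ 𝒞.Ψ ξ Complex.I))

/-- The `DJ`-term `ξ ↦ Ψ⁻¹ ((DJ(u₀ ξ)(Ψ ξ ·))(∂_y u₀ ξ))`. -/
def DJterm (ξ : ℂ) : F2 →L[ℝ] F2 :=
  (𝒞.Ψinv ξ).comp ((ContinuousLinearMap.apply ℝ E4 (fderiv ℝ u₀ ξ Complex.I)).comp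
    ((fderiv ℝ J (u₀ ξ)).comp (𝒞.Ψ ξ)))

/-- The conjugated linearisation `S = A + DJ-term` (the operator field of
`helper_linearisationTriangular`). -/
def S (ξ : ℂ) : F2 →L[ℝ] F2 :=
  (𝒞.Ψinv ξ).comp ((fderiv ℝ 𝒞.Ψ ξ (1 : ℂ)) + (J (u₀ ξ)).comp (fderiv ℝ 𝒞.Ψ ξ Complex.I) +
    (ContinuousLinearMap.apply ℝ E4 (fderiv ℝ u₀ ξ Complex.I)).comp
      ((fderiv ℝ J (u₀ ξ)).comp (𝒞.Ψ ξ)))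

/-- `S = A + DJ-term`. -/
theorem S_eq_A_add (ξ : ℂ) : 𝒞.S ξ = 𝒞.A ξ + 𝒞.DJterm ξ := by
  simp only [S, A, DJterm, ContinuousLinearMap.comp_add]

/-- `χ₁ = 1` on the support of `χ`. -/
theorem χ₁_eq_one_of_χ_ne_zero {z : ℂ} (hz : 𝒞.χ z ≠ 0) : 𝒞.χ₁ z = 1 := by
  apply 𝒞.hχ₁_one
  by_contra h
  exact hz (𝒞.hχ_zero z (by linarith [not_le.mp h]))

end ChartData

/-- **Existence of chart data at every member.** -/
theorem exists_chartData (J : E4 → E4 →L[ℝ] E4) (R : ℝ) (P Q : E4 →L[ℝ] ℂ) (eP eQ : ℂ →L[ℝ] E4)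
    (hR : 0 < R) (hJs : ContDiff ℝ ∞ J) (hJ2 : ∀ x v, J x (J x v) = -v)
    (hPQ : IsCoordFrame P Q eP eQ)
    (hJP : ∀ x : E4, R ≤ ‖x‖ → ∀ v, P (J x v) = Complex.I * P v)
    (hJQ : ∀ x : E4, R ≤ ‖x‖ → ∀ v, Q (J x v) = Complex.I * Q v)
    (b₀ : ℂ) (u₀ : ℂ → E4) (hu₀ : IsPencilMember J R P Q b₀ u₀) :
    Nonempty (ChartData J R P Q eP eQ b₀ u₀) := by
  -- the trivialisation along `u₀` (FRAME-a) feeds the adapted frame (FRAME-b)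
  obtain ⟨hu₀s, hu₀J, -, -, hQlim, -, -, -⟩ := id hu₀
  have hB : ∃ B, ∀ ξ : ℂ, ‖Q (u₀ ξ)‖ ≤ B := by
    have hc : Continuous fun ξ => Q (u₀ ξ) - b₀ := (Q.continuous.comp hu₀s.continuous).sub
      continuous_const
    have h0 : Tendsto (fun ξ => Q (u₀ ξ) - b₀) (cocompact ℂ) (𝓝 0) := by
      simpa using hQlim.sub_const b₀
    obtain ⟨M, hM⟩ := Continuity.exists_bound_of_tendsto_zero hc h0
    refine ⟨M + ‖b₀‖, fun ξ => ?_⟩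
    calc ‖Q (u₀ ξ)‖ = ‖(Q (u₀ ξ) - b₀) + b₀‖ := by rw [sub_add_cancel]
      _ ≤ ‖Q (u₀ ξ) - b₀‖ + ‖b₀‖ := norm_add_le _ _
      _ ≤ M + ‖b₀‖ := by gcongr; exact hM ξ
  obtain ⟨B, hB⟩ := hB
  have htriv := fun (ρ₀ : ℝ) (hfar : ∀ ξ : ℂ, ρ₀ ≤ ‖ξ‖ → R ≤ ‖P (u₀ ξ)‖) =>
    helper_complexTrivialisation J R P Q eP eQ hR hJs hJ2 hPQ hJP hJQ u₀ hu₀s ρ₀ B hfar hB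
  obtain ⟨Ψ, Ψinv, C, ρ₁, hρ₁, hΨs, hΨinvs, hleft, hright, hΨJ, hΨt, hΨfar, hΨbd, hΨinvbd, hfar⟩ :=
    helper_memberFrame J R P Q eP eQ hR hJs hJ2 hPQ hJP hJQ b₀ u₀ hu₀ htriv
  obtain ⟨χ, hχ, hχs, hχ1, hχ0, hχr⟩ := exists_cutoff (a := ρ₁ + 1) (b := ρ₁ + 2) (by linarith)
    (by linarith)
  obtain ⟨χ₁, hχ₁, hχ₁s, hχ₁1, hχ₁0, hχ₁r⟩ := exists_cutoff (a := ρ₁ + 2) (b := ρ₁ + 3)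
    (by linarith) (by linarith)
  exact ⟨⟨Ψ, Ψinv, C, ρ₁, χ, χ₁, hρ₁, hΨs, hΨinvs, hleft, hright, hΨJ, hΨt, hΨfar, hΨbd, hΨinvbd,
    hfar, hχ, hχs, hχ1, hχ0, hχr, hχ₁, hχ₁s, hχ₁1, hχ₁0, hχ₁r⟩⟩

namespace ChartData

variable {J : E4 → E4 →L[ℝ] E4} {R : ℝ} {P Q : E4 →L[ℝ] ℂ} {eP eQ : ℂ →L[ℝ] E4} {b₀ : ℂ}
  {u₀ : ℂ → E4} (𝒞 : ChartData J R P Q eP eQ b₀ u₀)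

/-- **Properties of `S`** (from `helper_linearisationTriangular`): smooth, kills the tangent
column, vanishes off the `ρ₁ + 1`-disc. -/
theorem S_props (hR : 0 < R) (hJs : ContDiff ℝ ∞ J) (hJ2 : ∀ x v, J x (J x v) = -v)
    (hPQ : IsCoordFrame P Q eP eQ)
    (hJP : ∀ x : E4, R ≤ ‖x‖ → ∀ v, P (J x v) = Complex.I * P v)
    (hJQ : ∀ x : E4, R ≤ ‖x‖ → ∀ v, Q (J x v) = Complex.I * Q v)
    (hu₀s : ContDiff ℝ ∞ u₀) (hu₀J : IsJHolomorphicFlat J u₀) :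
    ContDiff ℝ ∞ 𝒞.S ∧ (∀ ξ (y₁ : ℂ), 𝒞.S ξ (y₁, 0) = 0) ∧
      (∀ ξ, 𝒞.ρ₁ + 1 ≤ ‖ξ‖ → 𝒞.S ξ = 0) :=
  helper_linearisationTriangular J R P Q eP eQ hR hJs hJ2 hPQ hJP hJQ u₀ hu₀s hu₀J 𝒞.Ψ 𝒞.Ψinv
    𝒞.ρ₁ 𝒞.hΨs 𝒞.hΨinvs 𝒞.hleft 𝒞.hright 𝒞.hΨJ 𝒞.hΨt 𝒞.hΨfar 𝒞.hfar

/-- `S` is bounded (continuous and compactly supported). -/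
theorem S_bound (hS : ContDiff ℝ ∞ 𝒞.S) (hS0 : ∀ ξ, 𝒞.ρ₁ + 1 ≤ ‖ξ‖ → 𝒞.S ξ = 0) :
    ∃ M, ∀ ξ, ‖𝒞.S ξ‖ ≤ M := by
  have hc : Continuous fun ξ => ‖𝒞.S ξ‖ := hS.continuous.norm
  obtain ⟨M, hM⟩ := (isCompact_closedBall (0 : ℂ) (𝒞.ρ₁ + 1)).exists_bound_of_continuousOn
    hc.continuousOn
  refine ⟨max M 0, fun ξ => ?_⟩
  by_cases h : ‖ξ‖ ≤ 𝒞.ρ₁ + 1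
  · have := hM ξ (by simpa using h)
    rw [Real.norm_eq_abs, abs_of_nonneg (norm_nonneg _)] at this
    exact this.trans (le_max_left _ _)
  · rw [hS0 ξ (le_of_lt (not_le.mp h))]; simp

/-- Far out `J` is locally constant along `u₀`, so `DJ(u₀ ξ) = 0` (for `‖ξ‖ ≥ ρ₁`). -/
theorem fderiv_J_eq_zero (hPQ : IsCoordFrame P Q eP eQ)
    (hJP : ∀ x : E4, R ≤ ‖x‖ → ∀ v, P (J x v) = Complex.I * P v)
    (hJQ : ∀ x : E4, R ≤ ‖x‖ → ∀ v, Q (J x v) = Complex.I * Q v)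
    {ξ : ℂ} (hξ : 𝒞.ρ₁ ≤ ‖ξ‖) : fderiv ℝ J (u₀ ξ) = 0 := by
  have hx₀ : R < ‖u₀ ξ‖ := by
    have h1 := 𝒞.hfar ξ hξ
    have h2 := PencilDefs.norm_P_le hPQ (u₀ ξ)
    linarith
  have hJloc : J =ᶠ[𝓝 (u₀ ξ)] fun _ => J (u₀ ξ) := by
    filter_upwards [(isOpen_lt continuous_const continuous_norm).mem_nhds hx₀] with x hx
    refine ContinuousLinearMap.ext fun v => PencilDefs.eq_of_apply_eq hPQ ?_ ?_
    · rw [hJP x (le_of_lt hx) v, hJP (u₀ ξ) hx₀.le v]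
    · rw [hJQ x (le_of_lt hx) v, hJQ (u₀ ξ) hx₀.le v]
  rw [hJloc.fderiv_eq]
  exact fderiv_const_apply _

/-- `A = 0` off the `ρ₁ + 1`-disc. -/
theorem A_eq_zero (hPQ : IsCoordFrame P Q eP eQ)
    (hJP : ∀ x : E4, R ≤ ‖x‖ → ∀ v, P (J x v) = Complex.I * P v)
    (hJQ : ∀ x : E4, R ≤ ‖x‖ → ∀ v, Q (J x v) = Complex.I * Q v)
    (hS0 : ∀ ξ, 𝒞.ρ₁ + 1 ≤ ‖ξ‖ → 𝒞.S ξ = 0) {ξ : ℂ} (hξ : 𝒞.ρ₁ + 1 ≤ ‖ξ‖) : 𝒞.A ξ = 0 := by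
  have h1 := hS0 ξ hξ
  rw [S_eq_A_add] at h1
  have h2 : 𝒞.DJterm ξ = 0 := by
    have := 𝒞.fderiv_J_eq_zero hPQ hJP hJQ (le_trans (by linarith) hξ)
    simp [DJterm, this]
  rwa [h2, add_zero] at h1

end ChartData

end CoreA

/-- **Registered helper `helper_existsChartData`**: chart data (adapted frame with inverse,
conjugated linearisation coefficient, radii and nested cut-offs) exist at every pencil member. -/
theorem helper_existsChartData (J : EuclideanSpace ℝ (Fin 4) → EuclideanSpace ℝ (Fin 4) →L[ℝ]
      EuclideanSpace ℝ (Fin 4)) (R : ℝ) (P Q : EuclideanSpace ℝ (Fin 4) →L[ℝ] ℂ)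
    (eP eQ : ℂ →L[ℝ] EuclideanSpace ℝ (Fin 4))
    (hR : 0 < R) (hJs : ContDiff ℝ ∞ J) (hJ2 : ∀ x v, J x (J x v) = -v)
    (hPQ : IsCoordFrame P Q eP eQ)
    (hJP : ∀ x : EuclideanSpace ℝ (Fin 4), R ≤ ‖x‖ → ∀ v, P (J x v) = Complex.I * P v)
    (hJQ : ∀ x : EuclideanSpace ℝ (Fin 4), R ≤ ‖x‖ → ∀ v, Q (J x v) = Complex.I * Q v)
    (b₀ : ℂ) (u₀ : ℂ → EuclideanSpace ℝ (Fin 4)) (hu₀ : IsPencilMember J R P Q b₀ u₀) :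
    Nonempty (CoreA.ChartData J R P Q eP eQ b₀ u₀) :=
  CoreA.exists_chartData J R P Q eP eQ hR hJs hJ2 hPQ hJP hJQ b₀ u₀ hu₀

end Summit.SmoothPoincare4.SmoothPoincare4.Cruxes.TameOrBrodyR4.Sketch
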